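import Summits.AtomisticToContinuum.Crystallization.Theorems.EnergyDerivativeOrderLimitTransferHcpShells
import Summits.AtomisticToContinuum.Crystallization.Theorems.EnergyDerivativeOrderLimitTransferTestFunctions
import Summits.AtomisticToContinuum.Crystallization.Theorems.EnergyDerivativeOrderLimitTransferCounting
import HarnessLib

/-!
# Route EnergyDerivativeOrder · LimitTransfer — helper V: eventually a defect-free ball (Step A)

Support lemmas for item stmt-AtomisticToContinuum-12284 (`LimitTransfer`), combining helpers
I (hcp shells), II (window numerics, test functions) and IV (the counting step).

* `hcp_dist_cases` / `ok_cases` — in the window `|h/a − √(2/3)| ≤ 1/400` two distinct points of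
  `hcpStacking a h` are at a first-shell distance in `[0.9979 a, 1.00207 a]` or `≥ 1.4127 a`;
* `finite_hcpDist_inter_Icc` — the realised pair distances of hcp meet every `[0, M]` in a
  finite set (`12·dist² = a²·F + 12 K² h²` with bounded non-negative integers `F`, `K²`);
* `exists_forbidden_testFunction_hcp`, `exists_shell_testFunction_hcp` — the two test functions
  of the counting step with their hcp energies per particle `0` and `6`;
* `card_filter_dist_le` (packing), `shell_card_le_twelve` (the gapped kissing bound — the
  route's `GappedKissingBound`, unfolded, as a hypothesis — applied to a clean particle after
  rescaling by `a⁻¹`), and `eventually_exists_good`: for a uniformly `δ`-separated sequence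
  `x N : Fin N → ℝ³` whose smooth pair statistics converge to those of `hcp(a, h)`, for every
  `R ≥ 2a` and `0 < η ≤ a/4000`, eventually in `N` some particle `i` is good at scale `(R, η)`:
  all pairs in `B̄(x_i, R)` at distances within `η` of realised hcp distances, and every particle
  of the ball with exactly twelve others within `6a/5`.

All `[folklore]` (Blanc–Lewin 2015, §2.1, the step from pair statistics to (16)).
-/

noncomputable section

namespace Summit.AtomisticToContinuum.Crystallization.Theorems.EnergyDerivativeOrderLimitTransfer

section Spectrum

open Set Metric
open Literature.MathematicalPhysics.StatisticalMechanics

variable {a h : ℝ}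

/-! ## Distances in the window -/

/-- **Pair distances of hcp in the window**: first shell `[0.9979 a, 1.00207 a]` or `≥ 1.4127 a`.
[folklore] -/
theorem hcp_dist_cases (ha0 : 0 < a) (hw : |h / a - √(2 / 3)| ≤ 1 / 400)
    {p q : EuclideanSpace ℝ (Fin 3)} (hp : p ∈ hcpStacking a h) (hq : q ∈ hcpStacking a h)
    (hpq : p ≠ q) :
    (0.9979 * a ≤ dist p q ∧ dist p q ≤ 1.00207 * a) ∨ 1.4127 * a ≤ dist p q := by
  rcases dist_sq_cases_of_mem isHaggSeq_alternating hp hq hpq with h1 | h2 | hbig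
  · exact Or.inl (window_first_shell ha0 hw dist_nonneg (Or.inl h1))
  · exact Or.inl (window_first_shell ha0 hw dist_nonneg (Or.inr h2))
  · exact Or.inr (window_le_of_second_shell ha0 hw dist_nonneg hbig)

/-- A real number within `η` of a realised hcp pair distance is within `η` of the first-shell
window or exceeds `1.4127 a − η`. [folklore] -/
theorem ok_cases (ha0 : 0 < a) (hw : |h / a - √(2 / 3)| ≤ 1 / 400) {u η : ℝ}
    (hok : ∃ p ∈ hcpStacking a h, ∃ q ∈ hcpStacking a h, p ≠ q ∧ |u - dist p q| < η) :
    (0.9979 * a - η < u ∧ u < 1.00207 * a + η) ∨ 1.4127 * a - η < u := by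
  obtain ⟨p, hp, q, hq, hpq, hu⟩ := hok
  rw [abs_lt] at hu
  rcases hcp_dist_cases ha0 hw hp hq hpq with ⟨h1, h2⟩ | h3
  · left; constructor <;> linarith
  · right; linarith

/-! ## Local finiteness of the distance set -/

/-- A non-negative integer at most a real bound `r` is below `⌊r⌋₊ + 1`. [folklore] -/
theorem toNat_lt_floor_add_one {F : ℤ} (hF : 0 ≤ F) {r : ℝ} (hle : (F : ℝ) ≤ r) :
    F.toNat < ⌊r⌋₊ + 1 := by
  have h1 : ((F.toNat : ℕ) : ℝ) ≤ r := by
    have : ((F.toNat : ℤ) : ℝ) = (F : ℝ) := by rw [Int.toNat_of_nonneg hF]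
    have h2 : ((F.toNat : ℕ) : ℝ) = ((F.toNat : ℤ) : ℝ) := rfl
    rw [h2, this]; exact hle
  exact Nat.lt_succ_of_le (Nat.le_floor h1)

/-- **The realised pair distances of hcp meet every `[0, M]` in a finite set** (`0 < a`,
`0 < h`). [folklore] -/
theorem finite_hcpDist_inter_Icc (ha0 : 0 < a) (hh0 : 0 < h) (M : ℝ) :
    ({t : ℝ | ∃ p ∈ hcpStacking a h, ∃ q ∈ hcpStacking a h, p ≠ q ∧ t = dist p q} ∩
      Icc 0 M).Finite := by
  classical
  set B₁ : ℕ := ⌊12 * M ^ 2 / a ^ 2⌋₊ + 1 with hB₁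
  set B₂ : ℕ := ⌊M ^ 2 / h ^ 2⌋₊ + 1 with hB₂
  set g : ℕ × ℕ → ℝ := fun nm => √((a ^ 2 * nm.1 + 12 * nm.2 * h ^ 2) / 12) with hg
  refine ((Finset.range B₁ ×ˢ Finset.range B₂).finite_toSet.image g).subset ?_
  rintro t ⟨⟨p, hp, q, hq, -, rfl⟩, ht0, htM⟩
  obtain ⟨k, i, j, rfl⟩ := hp
  obtain ⟨k', i', j', rfl⟩ := hq
  have h12 := twelve_mul_dist_sq (a := a) (h := h) alternatingHagg k i j k' i' j'
  set F : ℤ := 3 * (2 * (i - i') + (j - j') +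
      (haggLabel alternatingHagg k - haggLabel alternatingHagg k')) ^ 2 +
    (3 * (j - j') + (haggLabel alternatingHagg k - haggLabel alternatingHagg k')) ^ 2 with hF
  set K2 : ℤ := (k - k') ^ 2 with hK2
  set D : ℝ := dist (barlowPos a h alternatingHagg k i j) (barlowPos a h alternatingHagg k' i' j')
    with hD
  have hF0 : 0 ≤ F := by positivity
  have hK20 : 0 ≤ K2 := by positivity
  have hF0' : (0 : ℝ) ≤ F := by exact_mod_cast hF0
  have hK20' : (0 : ℝ) ≤ K2 := by exact_mod_cast hK20
  have hD2 : D ^ 2 ≤ M ^ 2 := pow_le_pow_left₀ ht0 htM 2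
  have ha2 : 0 < a ^ 2 := by positivity
  have hh2 : 0 < h ^ 2 := by positivity
  have hFle : (F : ℝ) ≤ 12 * M ^ 2 / a ^ 2 := by
    rw [le_div_iff₀ ha2]
    nlinarith [mul_nonneg hK20' hh2.le]
  have hK2le : (K2 : ℝ) ≤ M ^ 2 / h ^ 2 := by
    rw [le_div_iff₀ hh2]
    nlinarith [mul_nonneg hF0' ha2.le]
  refine ⟨(F.toNat, K2.toNat), ?_, ?_⟩
  · simp only [Finset.coe_product, Finset.coe_range, Set.mem_prod, Set.mem_Iio]
    exact ⟨toNat_lt_floor_add_one hF0 hFle, toNat_lt_floor_add_one hK20 hK2le⟩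
  · have h1 : ((F.toNat : ℕ) : ℝ) = (F : ℝ) := by
      have : ((F.toNat : ℤ) : ℝ) = (F : ℝ) := by rw [Int.toNat_of_nonneg hF0]
      exact this
    have h2 : ((K2.toNat : ℕ) : ℝ) = (K2 : ℝ) := by
      have : ((K2.toNat : ℤ) : ℝ) = (K2 : ℝ) := by rw [Int.toNat_of_nonneg hK20]
      exact this
    simp only [hg, h1, h2]
    rw [← Real.sqrt_sq ht0]
    congr 1
    linarith

/-! ## The two test functions for hcp -/

/-- **Forbidden-distance test function for hcp**: `C²`, compactly supported, `≥ 0`, of hcp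
energy per particle `0`, and equal to `1` at every `r ∈ [δ, L]` which is NOT within `η` of a
realised pair distance of `hcpStacking a h`. [folklore] -/
theorem exists_forbidden_testFunction_hcp (ha : a ≠ 0) (hh : h ≠ 0) (δ L : ℝ) {η : ℝ}
    (hη : 0 < η) :
    ∃ W : ℝ → ℝ, ContDiff ℝ 2 W ∧ HasCompactSupport W ∧ (∀ r, 0 ≤ W r) ∧
      (hcpPeriodicConfiguration ha hh).energyPerParticle W = 0 ∧
      (∀ r, δ ≤ r → r ≤ L →
        (¬ ∃ p ∈ hcpStacking a h, ∃ q ∈ hcpStacking a h, p ≠ q ∧ |r - dist p q| < η) →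
          W r = 1) := by
  obtain ⟨W, hW, hWc, hW0, hWA, hW1⟩ := exists_forbidden_testFunction
    {t : ℝ | ∃ p ∈ hcpStacking a h, ∃ q ∈ hcpStacking a h, p ≠ q ∧ t = dist p q} δ L hη
  refine ⟨W, hW, hWc, hW0, ?_, fun r hr1 hr2 hnot => hW1 r hr1 hr2 ?_⟩
  · apply energyPerParticle_eq_zero_of
    intro p hp q hq hpq
    rw [hcpPeriodicConfiguration_points] at hp hq
    exact hWA _ ⟨p, hp, q, hq, hpq, rfl⟩
  · rintro t ⟨p, hp, q, hq, hpq, rfl⟩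
    by_contra hlt
    push Not at hlt
    exact hnot ⟨p, hp, q, hq, hpq, hlt⟩

/-- **Shell test function for hcp**: `C²`, compactly supported, `0 ≤ W ≤ 1`, of hcp energy per
particle `6`, and vanishing beyond `6a/5` (for a tolerance `η ≤ a/4000`, in the window).
[folklore] -/
theorem exists_shell_testFunction_hcp (ha : a ≠ 0) (hh : h ≠ 0) (ha0 : 0 < a)
    (hw : |h / a - √(2 / 3)| ≤ 1 / 400) {η : ℝ} (hη : 0 < η) (hηa : η ≤ a / 4000) :
    ∃ W : ℝ → ℝ, ContDiff ℝ 2 W ∧ HasCompactSupport W ∧ (∀ r, 0 ≤ W r ∧ W r ≤ 1) ∧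
      (hcpPeriodicConfiguration ha hh).energyPerParticle W = 6 ∧
      (∀ r, W r ≠ 0 → r ≤ 6 / 5 * a) := by
  obtain ⟨W, hW, hWc, hW01, hW1, hWsupp⟩ :=
    exists_shell_testFunction (0.9979 * a) (1.00207 * a) hη
  refine ⟨W, hW, hWc, hW01, ?_, fun r hr => ?_⟩
  · obtain ⟨ha'1, ha'2⟩ := window_aprime_bounds ha0 hw
    obtain ⟨hs1, hs2, hs3⟩ := window_second_shell ha0 hw
    obtain ⟨hh1, hh2⟩ := window_h_sq_bounds ha0 hw
    have hρ : 1.00207 * a + η ≤ 1.0024 * a := by linarith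
    refine energyPerParticle_hcp_eq_six_of ha hh ha0 (ρ := 1.00207 * a + η) (by linarith)
      (by linarith) (by nlinarith) (by nlinarith) (by nlinarith) W ?_ ?_
    · intro p hp q hq hpq hd
      rcases hcp_dist_cases ha0 hw hp hq hpq with ⟨h1, h2⟩ | h3
      · exact hW1 _ ⟨h1, h2⟩
      · exfalso; linarith
    · intro p _ q _ hd
      by_contra hne
      have := (hWsupp _ hne).2
      linarith
  · have := (hWsupp r hr).2
    linarith

end Spectrum

section StepA

open scoped BigOperators Topology
open Finset Metric Filter
open Literature.MathematicalPhysics.StatisticalMechanics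

variable {a h : ℝ}

/-! ## Packing counts -/

/-- A uniformly separated configuration is injective. [folklore] -/
theorem injective_of_sep {N : ℕ} {y : Fin N → EuclideanSpace ℝ (Fin 3)} {δ : ℝ} (hδ : 0 < δ)
    (hsep : ∀ i j, i ≠ j → δ ≤ dist (y i) (y j)) : Function.Injective y := by
  intro i j hij
  by_contra hne
  have := hsep i j hne
  rw [hij, dist_self] at this
  linarith

/-- **Packing count**: at most `(2R/δ + 1)³` particles of a `δ`-separated configuration lie in
a ball of radius `R`. [folklore] -/
theorem card_filter_dist_le {N : ℕ} (y : Fin N → EuclideanSpace ℝ (Fin 3)) {δ : ℝ} (hδ : 0 < δ)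
    (hsep : ∀ i j, i ≠ j → δ ≤ dist (y i) (y j)) (c : EuclideanSpace ℝ (Fin 3)) {R : ℝ}
    (hR : 0 ≤ R) :
    ((univ.filter fun j => dist (y j) c ≤ R).card : ℝ) ≤ (2 * R / δ + 1) ^ 3 := by
  classical
  set F := univ.filter fun j => dist (y j) c ≤ R with hF
  have hinj := injective_of_sep hδ hsep
  have hcard : (F.image y).card = F.card := Finset.card_image_of_injective _ hinj
  have h := card_le_of_separated_of_dist_le (F.image y) c hδ hR ?_ ?_
  · rw [hcard, finrank_euclideanSpace_fin] at h
    exact h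
  · intro p hp
    obtain ⟨j, hj, rfl⟩ := Finset.mem_image.1 hp
    exact (Finset.mem_filter.1 hj).2
  · intro p hp q hq hpq
    obtain ⟨j, -, rfl⟩ := Finset.mem_image.1 hp
    obtain ⟨j', -, rfl⟩ := Finset.mem_image.1 hq
    exact hsep j j' fun hjj' => hpq (by rw [hjj'])

/-- **Shell count bound**: at most `(2ρ/δ + 1)³` other particles within `ρ` of a particle.
[folklore] -/
theorem card_shell_le {N : ℕ} (y : Fin N → EuclideanSpace ℝ (Fin 3)) {δ : ℝ} (hδ : 0 < δ)
    (hsep : ∀ i j, i ≠ j → δ ≤ dist (y i) (y j)) (i : Fin N) {ρ : ℝ} (hρ : 0 ≤ ρ) :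
    ((univ.filter fun j => j ≠ i ∧ dist (y j) (y i) ≤ ρ).card : ℝ) ≤ (2 * ρ / δ + 1) ^ 3 := by
  classical
  refine le_trans ?_ (card_filter_dist_le y hδ hsep (y i) hρ)
  exact_mod_cast Finset.card_le_card fun j hj => by
    simp only [Finset.mem_filter, Finset.mem_univ, true_and] at hj ⊢
    exact hj.2

/-! ## The gapped kissing bound at a clean particle -/

/-- `√2 < 1.41422`. [folklore] -/
theorem sqrt_two_lt : √2 < (1.41422 : ℝ) := by
  rw [Real.sqrt_lt' (by norm_num)]; norm_num

/-- **A clean particle has at most twelve first-shell neighbours.** If all pairs among the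
particles of `B̄(y_i, R)` (`R ≥ 6a/5`) are at distances within `η ≤ a/4000` of realised hcp
pair distances (window), then at most twelve particles other than `i` lie within `6a/5` of
`y_i` — the gapped kissing bound applied to the shell rescaled by `a⁻¹`. [folklore] -/
theorem shell_card_le_twelve
    (hGKB : ∀ (c : EuclideanSpace ℝ (Fin 3)) (T : Finset (EuclideanSpace ℝ (Fin 3))),
      (∀ p ∈ T, 399 / 400 ≤ dist p c ∧ dist p c ≤ 401 / 400) →
      (∀ p ∈ T, ∀ q ∈ T, p ≠ q → (399 / 400 ≤ dist p q ∧ dist p q ≤ 401 / 400) ∨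
        Real.sqrt 2 - 1 / 100 ≤ dist p q) → T.card ≤ 12)
    (ha0 : 0 < a) (hw : |h / a - √(2 / 3)| ≤ 1 / 400) {N : ℕ} (y : Fin N → EuclideanSpace ℝ (Fin 3))
    {R η : ℝ} (hR : 6 / 5 * a ≤ R) (hηa : η ≤ a / 4000) (i : Fin N)
    (hclean : ∀ l l', dist (y l) (y i) ≤ R → dist (y l') (y i) ≤ R → l ≠ l' →
      ∃ p ∈ hcpStacking a h, ∃ q ∈ hcpStacking a h, p ≠ q ∧ |dist (y l) (y l') - dist p q| < η) :
    (univ.filter fun j => j ≠ i ∧ dist (y j) (y i) ≤ 6 / 5 * a).card ≤ 12 := by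
  classical
  set F := univ.filter fun j => j ≠ i ∧ dist (y j) (y i) ≤ 6 / 5 * a with hF
  have hsq2 := sqrt_two_lt
  -- distances among the particles of the ball, up to `η`
  have hokF : ∀ l ∈ F, ∀ l' ∈ insert i F, l ≠ l' →
      (0.9979 * a - η < dist (y l) (y l') ∧ dist (y l) (y l') < 1.00207 * a + η) ∨
        1.4127 * a - η < dist (y l) (y l') := by
    intro l hl l' hl' hll'
    have hl2 := (Finset.mem_filter.1 hl).2
    have hl'R : dist (y l') (y i) ≤ R := by
      rcases Finset.mem_insert.1 hl' with rfl | hl'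
      · rw [dist_self]; linarith
      · linarith [(Finset.mem_filter.1 hl').2.2]
    exact ok_cases ha0 hw (hclean l l' (by linarith [hl2.2]) hl'R hll')
  have hcentre : ∀ l ∈ F,
      0.9979 * a - η < dist (y l) (y i) ∧ dist (y l) (y i) < 1.00207 * a + η := by
    intro l hl
    have hl2 := (Finset.mem_filter.1 hl).2
    rcases hokF l hl i (Finset.mem_insert_self _ _) hl2.1 with h1 | h2
    · exact h1
    · exfalso; linarith [hl2.2]
  -- the rescaled shell
  have hdist : ∀ p q : EuclideanSpace ℝ (Fin 3), dist (a⁻¹ • p) (a⁻¹ • q) = dist p q / a := by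
    intro p q
    rw [dist_smul₀, norm_inv, Real.norm_of_nonneg ha0.le, div_eq_inv_mul]
  have hinj : Set.InjOn (fun l => a⁻¹ • y l) ↑F := by
    intro l hl l' hl' hll'
    by_contra hne
    have h0 : dist (y l) (y l') = 0 := by
      have hll'' : a⁻¹ • y l = a⁻¹ • y l' := hll'
      have h1 : dist (a⁻¹ • y l) (a⁻¹ • y l') = 0 := by rw [hll'', dist_self]
      rw [hdist, div_eq_zero_iff] at h1
      exact h1.resolve_right ha0.ne'
    rcases hokF l hl l' (Finset.mem_insert_of_mem hl') hne with h1 | h2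
    · linarith [h1.1]
    · linarith
  have hcardT : (F.image fun l => a⁻¹ • y l).card = F.card := Finset.card_image_of_injOn hinj
  rw [← hcardT]
  refine hGKB (a⁻¹ • y i) (F.image fun l => a⁻¹ • y l) ?_ ?_
  · intro p hp
    obtain ⟨l, hl, rfl⟩ := Finset.mem_image.1 hp
    obtain ⟨h1, h2⟩ := hcentre l hl
    rw [hdist]
    constructor
    · rw [le_div_iff₀ ha0]; linarith
    · rw [div_le_iff₀ ha0]; linarith
  · intro p hp q hq hpq
    obtain ⟨l, hl, rfl⟩ := Finset.mem_image.1 hp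
    obtain ⟨l', hl', rfl⟩ := Finset.mem_image.1 hq
    have hll' : l ≠ l' := fun h => hpq (by rw [h])
    rw [hdist]
    rcases hokF l hl l' (Finset.mem_insert_of_mem hl') hll' with ⟨h1, h2⟩ | h3
    · left
      constructor
      · rw [le_div_iff₀ ha0]; linarith
      · rw [div_le_iff₀ ha0]; linarith
    · right
      rw [le_div_iff₀ ha0]
      nlinarith

/-! ## Step A: eventually a good particle -/

/-- **Eventually a defect-free ball** (Step A of `LimitTransfer`). See the module docstring.
[folklore] -/
theorem eventually_exists_good
    (hGKB : ∀ (c : EuclideanSpace ℝ (Fin 3)) (T : Finset (EuclideanSpace ℝ (Fin 3))),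
      (∀ p ∈ T, 399 / 400 ≤ dist p c ∧ dist p c ≤ 401 / 400) →
      (∀ p ∈ T, ∀ q ∈ T, p ≠ q → (399 / 400 ≤ dist p q ∧ dist p q ≤ 401 / 400) ∨
        Real.sqrt 2 - 1 / 100 ≤ dist p q) → T.card ≤ 12)
    (ha : a ≠ 0) (hh : h ≠ 0) (ha0 : 0 < a) (hw : |h / a - √(2 / 3)| ≤ 1 / 400)
    (x : (N : ℕ) → (Fin N → EuclideanSpace ℝ (Fin 3))) {δ : ℝ} (hδ : 0 < δ)
    (hsep : ∀ (N : ℕ) (i j : Fin N), i ≠ j → δ ≤ dist (x N i) (x N j))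
    (hstat : ∀ W : ℝ → ℝ, ContDiff ℝ 2 W → HasCompactSupport W →
      Tendsto (fun N : ℕ => interactionEnergy W (x N) / N) atTop
        (𝓝 ((hcpPeriodicConfiguration ha hh).energyPerParticle W)))
    {R η : ℝ} (hR : 2 * a ≤ R) (hη : 0 < η) (hηa : η ≤ a / 4000) :
    ∀ᶠ N in atTop, ∃ i : Fin N,
      (∀ l l', dist (x N l) (x N i) ≤ R → dist (x N l') (x N i) ≤ R → l ≠ l' →
        ∃ p ∈ hcpStacking a h, ∃ q ∈ hcpStacking a h,
          p ≠ q ∧ |dist (x N l) (x N l') - dist p q| < η) ∧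
      ∀ j, dist (x N j) (x N i) ≤ R →
        (univ.filter fun l => l ≠ j ∧ dist (x N l) (x N j) ≤ 6 / 5 * a).card = 12 := by
  classical
  have hR0 : 0 ≤ R := by linarith
  -- the two test functions and their hcp energies per particle
  obtain ⟨Wf, hWf, hWfc, hWf0, heWf, hWf1⟩ := exists_forbidden_testFunction_hcp ha hh δ (2 * R) hη
  obtain ⟨Ws, hWs, hWsc, hWs01, heWs, hWsρ⟩ := exists_shell_testFunction_hcp ha hh ha0 hw hη hηa
  -- packing constants
  set K : ℝ := (2 * (6 / 5 * a) / δ + 1) ^ 3 with hK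
  set C : ℝ := (2 * R / δ + 1) ^ 3 with hC
  have hC0 : 0 ≤ C := by positivity
  -- the statistics: the defect functional per particle tends to `0`
  have hf := hstat Wf hWf hWfc
  have hs := hstat Ws hWs hWsc
  rw [heWf] at hf
  rw [heWs] at hs
  have hΦ : Tendsto (fun N : ℕ => C * ((K + 1) * (C * (2 * (interactionEnergy Wf (x N) / N))) +
      (12 - 2 * (interactionEnergy Ws (x N) / N)))) atTop (𝓝 0) := by
    have := ((((hf.const_mul 2).const_mul C).const_mul (K + 1)).add
      ((tendsto_const_nhds (x := (12 : ℝ))).sub (hs.const_mul 2))).const_mul C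
    have h0 : C * ((K + 1) * (C * (2 * 0)) + (12 - 2 * 6)) = (0 : ℝ) := by ring
    rw [h0] at this
    exact this
  filter_upwards [hΦ.eventually (gt_mem_nhds zero_lt_one), eventually_gt_atTop 0] with N hN hNpos
  have hNr : (0 : ℝ) < N := by exact_mod_cast hNpos
  refine exists_good_particle (x N)
    (fun u => ∃ p ∈ hcpStacking a h, ∃ q ∈ hcpStacking a h, p ≠ q ∧ |u - dist p q| < η)
    hNpos hR0 hC0 (fun i => card_shell_le (x N) hδ (hsep N) i (by positivity))
    (fun c => card_filter_dist_le (x N) hδ (hsep N) c hR0) hWf0 ?_ hWs01 hWsρ ?_ ?_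
  · intro l l' hll' h2R hnot
    exact (hWf1 _ (hsep N l l' hll') h2R hnot).symm.le
  · intro i hci
    exact shell_card_le_twelve hGKB ha0 hw (x N) (by linarith) hηa i hci
  · have key : C * ((K + 1) * (C * (2 * interactionEnergy Wf (x N))) +
        (12 * N - 2 * interactionEnergy Ws (x N))) =
        N * (C * ((K + 1) * (C * (2 * (interactionEnergy Wf (x N) / N))) +
          (12 - 2 * (interactionEnergy Ws (x N) / N)))) := by
      field_simp
    rw [key]
    calc (N : ℝ) * _ < N * 1 := by gcongr
      _ = N := mul_one _

end StepA

end Summit.AtomisticToContinuum.Crystallization.Theorems.EnergyDerivativeOrderLimitTransfer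

end
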